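import Mathlib.Algebra.Algebra.Rat
import Mathlib.FieldTheory.PolynomialGaloisGroup
import Mathlib.FieldTheory.PrimitiveElement
import Mathlib.LinearAlgebra.Dual.Lemmas
import Mathlib.Algebra.Polynomial.Roots
import HarnessLib

/-!
# Rational points of the torus through a semisimple element: norm points (Mumford–Tate invariants, step 7)

Let `p ∈ ℚ[X]` (later: the minimal polynomial of a semisimple `S ∈ End_ℚ V`), `L` its splitting
field, `G = Gal(L/ℚ)` and `R ⊆ L` the roots. The algebraic torus `𝒜(S)` "generated" by `S` (the
smallest algebraic subgroup of `GL(V)` whose Lie algebra contains `S`; Borel, *Linear Algebraic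
Groups*, 2nd ed., §7.3; Chevalley) has, over `L`, the points `μ ↦ c^{ν(μ)}` for `c ∈ L^×` and
`ν : R → ℤ` the restriction of a `ℚ`-linear form `φ : L → ℚ` (these respect every additive
relation `Σ M(μ) μ = 0` among the eigenvalues). Taking NORMS produces RATIONAL points: this file
constructs the family of values

  `normPoint ν c μ = ∏_{σ ∈ G} σ(c) ^ ν(σ⁻¹ μ)`     (`μ ∈ R`)

and proves: it is Galois-equivariant (`gal_apply_normPoint`, so it descends to a polynomial in
`S` with rational coefficients, next file), it satisfies every multiplicative relation coming from
an additive relation among the roots (`prod_normPoint_zpow_eq_one`), and — the point of the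
construction — for `c = r + α` (`α` a primitive element, `r ∈ ℚ` generic) it VIOLATES the
multiplicative relation attached to any `M` with `Σ M(μ) μ ≠ 0` (`exists_normPoint_family`: a
root-counting argument with the polynomials `∏ (X + σα)^{e(σ)^±}`). This is the unirationality of
tori (Borel, op. cit., 8.13–8.14: induced tori are rational, their norm images have dense rational
points) made explicit for `𝒜(S)`; it supplies the rational points of the Mumford–Tate group through
its semisimple directions in the proof of `Deligne1982_mumfordTateInvariants` (cf. Borel 18.2–18.3).
Also: a linear form avoiding finitely many non-zero vectors (`exists_dual_forall_ne_zero`).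

## References

* A. Borel, *Linear Algebraic Groups*, 2nd ed., GTM 126 (1991), §7.3, 8.13–8.14, 18.2–18.3.
* P. Deligne, *Hodge cycles on abelian varieties*, LNM 900 (1982), I §3.
-/

noncomputable section

open Polynomial

namespace Literature.AlgebraicGeometry.Motives

universe u v

/-! ### A linear form avoiding finitely many non-zero vectors -/

section Dual

variable {K : Type u} [Field K] [Infinite K] {W : Type v} [AddCommGroup W] [Module K W]

/-- Over an infinite field, finitely many non-zero vectors can be simultaneously avoided by a
linear form (a vector space is not a finite union of hyperplanes). [folklore] -/
theorem exists_dual_forall_ne_zero (s : Finset W) (hs : ∀ w ∈ s, w ≠ 0) :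
    ∃ φ : Module.Dual K W, ∀ w ∈ s, φ w ≠ 0 := by
  classical
  induction s using Finset.induction_on with
  | empty => exact ⟨0, by simp⟩
  | insert v s hv ih =>
    obtain ⟨φ, hφ⟩ := ih fun w hw => hs w (Finset.mem_insert_of_mem hw)
    have hv0 : v ≠ 0 := hs v (Finset.mem_insert_self v s)
    obtain ⟨ψ, hψ⟩ : ∃ ψ : Module.Dual K W, ψ v ≠ 0 := by
      by_contra h
      push Not at h
      exact hv0 ((Module.forall_dual_apply_eq_zero_iff K v).1 h)
    -- avoid the finitely many `t` with `(φ + t ψ) w = 0` for some `w`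
    obtain ⟨t, ht⟩ := Infinite.exists_notMem_finset
      ((insert v s).image fun w => -(φ w) / ψ w)
    refine ⟨φ + t • ψ, fun w hw h0 => ?_⟩
    simp only [LinearMap.add_apply, LinearMap.smul_apply, smul_eq_mul] at h0
    by_cases hψw : ψ w = 0
    · rw [hψw, mul_zero, add_zero] at h0
      rcases Finset.mem_insert.1 hw with rfl | hw'
      · exact hψ hψw
      · exact hφ w hw' h0
    · apply ht
      refine Finset.mem_image.2 ⟨w, hw, ?_⟩
      rw [div_eq_iff hψw]
      linear_combination -h0

end Dual

/-! ### Norm points of the torus through the roots of a rational polynomial -/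

section Norm

variable {F : Type u} [Field F] {p : F[X]}

/-- The Galois group of `p` acts on the roots of `p` in its splitting field through the
automorphisms: `↑(σ • μ) = σ μ`. [folklore] -/
theorem coe_gal_smul (σ : p.Gal) (μ : p.rootSet p.SplittingField) :
    ((σ • μ : p.rootSet p.SplittingField) : p.SplittingField) = σ μ :=
  rfl

/-- Products of integer powers with a non-zero base turn sums of exponents into products.
[folklore] -/
theorem prod_zpow_eq_zpow_sum {K : Type u} [Field K] {ι : Type v} (s : Finset ι) (f : ι → ℤ)
    {a : K} (ha : a ≠ 0) : ∏ i ∈ s, a ^ f i = a ^ ∑ i ∈ s, f i := by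
  classical
  induction s using Finset.induction_on with
  | empty => simp
  | insert i s hi ih => rw [Finset.prod_insert hi, Finset.sum_insert hi, ih, zpow_add₀ ha]

/-- The **norm point** attached to integer weights `ν` on the roots and a scalar `c`:
`μ ↦ ∏_{σ ∈ Gal} σ(c) ^ ν(σ⁻¹ μ)` — the `μ`-component of the norm `N_{L/ℚ}` of the `L`-point
`μ ↦ c^{ν(μ)}` of the torus (Borel, *Linear Algebraic Groups*, 8.13: norms of points of the
induced torus). [folklore] -/
def normPoint (ν : p.rootSet p.SplittingField → ℤ) (c : p.SplittingField)
    (μ : p.rootSet p.SplittingField) : p.SplittingField :=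
  ∏ σ : p.Gal, σ c ^ ν (σ⁻¹ • μ)

/-- Norm points are non-zero for `c ≠ 0`. [folklore] -/
theorem normPoint_ne_zero (ν : p.rootSet p.SplittingField → ℤ) {c : p.SplittingField} (hc : c ≠ 0)
    (μ : p.rootSet p.SplittingField) : normPoint ν c μ ≠ 0 :=
  Finset.prod_ne_zero_iff.2 fun σ _ => zpow_ne_zero _ ((map_ne_zero σ).2 hc)

/-- **Galois equivariance of the norm points**: `τ (U μ) = U (τ μ)` (a norm is Galois-invariant;
this is what makes the interpolating polynomial rational). [folklore] -/
theorem gal_apply_normPoint (ν : p.rootSet p.SplittingField → ℤ) (c : p.SplittingField)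
    (τ : p.Gal) (μ : p.rootSet p.SplittingField) :
    τ (normPoint ν c μ) = normPoint ν c (τ • μ) := by
  unfold normPoint
  rw [map_prod]
  simp_rw [map_zpow₀]
  -- reindex `σ ↦ τ σ`
  refine Fintype.prod_equiv (Equiv.mulLeft τ) _ _ fun σ => ?_
  simp only [Equiv.coe_mulLeft, mul_inv_rev, mul_smul, inv_smul_smul]
  rfl

/-- The exponent of `σ(c)` in `∏ U(μ)^{M(μ)}`: `e_M(σ) = Σ_μ ν(σ⁻¹ μ) M(μ)`. [folklore] -/
def normExponent (ν M : p.rootSet p.SplittingField → ℤ) (σ : p.Gal) : ℤ :=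
  ∑ μ, ν (σ⁻¹ • μ) * M μ

/-- `∏ U(μ)^{M(μ)} = ∏_σ σ(c) ^ e_M(σ)`. [folklore] -/
theorem prod_normPoint_zpow_eq (ν : p.rootSet p.SplittingField → ℤ) {c : p.SplittingField}
    (hc : c ≠ 0) (M : p.rootSet p.SplittingField → ℤ) :
    ∏ μ, normPoint ν c μ ^ M μ = ∏ σ : p.Gal, σ c ^ normExponent ν M σ := by
  unfold normPoint normExponent
  simp_rw [← Finset.prod_zpow, ← zpow_mul]
  rw [Finset.prod_comm]
  refine Finset.prod_congr rfl fun σ _ => ?_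
  rw [prod_zpow_eq_zpow_sum _ _ ((map_ne_zero σ).2 hc)]

variable [CharZero F]

/-- **Norm points satisfy the multiplicative relations coming from additive relations among
the roots**: if the weights are the restriction of a `ℚ`-linear form `φ` (`ν μ = φ μ`) and
`Σ M(μ) μ = 0`, then `∏ U(μ) ^ M(μ) = 1` — the norm points lie in the torus cut out by the
relations (Borel 8.13). [folklore] -/
theorem prod_normPoint_zpow_eq_one (ν : p.rootSet p.SplittingField → ℤ)
    (φ : p.SplittingField →ₗ[ℚ] ℚ) (hν : ∀ μ, (ν μ : ℚ) = φ μ) {c : p.SplittingField} (hc : c ≠ 0)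
    (M : p.rootSet p.SplittingField → ℤ)
    (hM : ∑ μ, M μ • (μ : p.SplittingField) = 0) :
    ∏ μ, normPoint ν c μ ^ M μ = 1 := by
  unfold normPoint
  simp_rw [← Finset.prod_zpow, ← zpow_mul]
  rw [Finset.prod_comm]
  refine Finset.prod_eq_one fun σ _ => ?_
  rw [prod_zpow_eq_zpow_sum _ _ ((map_ne_zero σ).2 hc)]
  suffices h : ∑ μ, ν (σ⁻¹ • μ) * M μ = 0 by rw [h, zpow_zero]
  have hq : ((∑ μ, ν (σ⁻¹ • μ) * M μ : ℤ) : ℚ) = φ (σ⁻¹ (∑ μ, M μ • (μ : p.SplittingField))) := by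
    rw [map_sum, map_sum]
    push_cast
    refine Finset.sum_congr rfl fun μ _ => ?_
    rw [hν, map_zsmul, map_zsmul, zsmul_eq_mul, mul_comm, coe_gal_smul]
  rw [hM, map_zero, map_zero] at hq
  exact_mod_cast hq

/-- The exponent at the identity is `φ (Σ M(μ) μ)`: it is non-zero as soon as the linear form
does not vanish on the (non-zero) sum. [folklore] -/
theorem cast_normExponent_one (ν : p.rootSet p.SplittingField → ℤ)
    (φ : p.SplittingField →ₗ[ℚ] ℚ) (hν : ∀ μ, (ν μ : ℚ) = φ μ)
    (M : p.rootSet p.SplittingField → ℤ) :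
    (normExponent ν M 1 : ℚ) = φ (∑ μ, M μ • (μ : p.SplittingField)) := by
  unfold normExponent
  rw [map_sum]
  push_cast
  refine Finset.sum_congr rfl fun μ _ => ?_
  rw [hν, map_zsmul, zsmul_eq_mul, mul_comm, inv_one, one_smul]

/-! ### The generic choice `c = r + α` -/

/-- Splitting an integer power into natural powers: `a ^ e = a ^ e⁺ (a ^ e⁻)⁻¹`, valid also at
`a = 0` with the conventions `0⁻¹ = 0`. [folklore] -/
theorem zpow_eq_pow_toNat_mul_inv {K : Type u} [Field K] (a : K) (e : ℤ) :
    a ^ e = a ^ e.toNat * (a ^ (-e).toNat)⁻¹ := by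
  rcases le_or_gt 0 e with he | he
  · rw [Int.toNat_of_nonpos (by omega : -e ≤ 0), pow_zero, inv_one, mul_one, ← zpow_natCast,
      Int.toNat_of_nonneg he]
  · rw [Int.toNat_of_nonpos he.le, pow_zero, one_mul, ← zpow_natCast,
      Int.toNat_of_nonneg (by omega : 0 ≤ -e), zpow_neg, inv_inv]

/-- **Root-counting lemma.** For a finite family of DISTINCT scalars `a σ` and integer exponents
`e` with `e σ₀ ≠ 0` for some `σ₀`, only finitely many rationals `r` satisfy
`∏_σ (r + a σ) ^ e σ = 1`: otherwise the polynomials `∏ (X + a σ)^{e σ⁺}` and `∏ (X + a σ)^{e σ⁻}`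
agree at infinitely many points, hence are equal, but exactly one of them vanishes at `-a σ₀`.
[folklore] -/
theorem finite_setOf_prod_add_zpow_eq_one {K : Type u} [Field K] [CharZero K] {ι : Type v}
    [Fintype ι] (a : ι → K) (ha : Function.Injective a) (e : ι → ℤ) {σ₀ : ι} (he : e σ₀ ≠ 0) :
    Set.Finite {r : ℚ | ∏ σ, ((r : K) + a σ) ^ e σ = 1} := by
  -- WLOG `e σ₀ > 0` (replace `e` by `-e`)
  wlog hpos : 0 < e σ₀ generalizing e
  · have h := this (fun σ => -e σ) (by simpa using he) (by omega)
    refine (h.subset fun r hr => ?_)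
    simp only [Set.mem_setOf_eq, zpow_neg, Finset.prod_inv_distrib] at hr ⊢
    rw [hr, inv_one]
  let P : K[X] := ∏ σ, (X + C (a σ)) ^ (e σ).toNat
  let Q : K[X] := ∏ σ, (X + C (a σ)) ^ (-e σ).toNat
  have hPQ : ∀ x : K, ∏ σ, (x + a σ) ^ e σ = P.eval x * (Q.eval x)⁻¹ := by
    intro x
    simp only [P, Q, eval_prod, eval_pow, eval_add, eval_X, eval_C, ← Finset.prod_inv_distrib,
      ← Finset.prod_mul_distrib]
    exact Finset.prod_congr rfl fun σ _ => zpow_eq_pow_toNat_mul_inv _ _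
  rw [← Set.not_infinite]
  intro hinf
  have hsub : Set.Infinite {x : K | P.eval x = Q.eval x} := by
    refine (hinf.image (Rat.cast_injective (α := K)).injOn).mono ?_
    rintro _ ⟨r, hr, rfl⟩
    simp only [Set.mem_setOf_eq, hPQ] at hr ⊢
    by_cases hQ : Q.eval (r : K) = 0
    · rw [hQ, inv_zero, mul_zero] at hr
      exact absurd hr zero_ne_one
    · exact (mul_inv_eq_one₀ hQ).1 hr
  have hPQeq : P = Q := Polynomial.eq_of_infinite_eval_eq P Q hsub
  have hP0 : P.eval (-a σ₀) = 0 := by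
    simp only [P, eval_prod, eval_pow, eval_add, eval_X, eval_C]
    refine Finset.prod_eq_zero (Finset.mem_univ σ₀) ?_
    rw [neg_add_cancel, zero_pow]
    omega
  have hQ0 : Q.eval (-a σ₀) ≠ 0 := by
    simp only [Q, eval_prod, eval_pow, eval_add, eval_X, eval_C]
    refine Finset.prod_ne_zero_iff.2 fun σ _ => ?_
    by_cases hσ : σ = σ₀
    · subst hσ
      rw [Int.toNat_of_nonpos (by omega), pow_zero]
      exact one_ne_zero
    · refine pow_ne_zero _ fun h0 => hσ (ha ?_)
      rw [neg_add_eq_zero] at h0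
      exact h0.symm
  rw [hPQeq] at hP0
  exact hQ0 hP0

/-- Integral weights from a linear form: clearing denominators on the finitely many roots gives
`ν : R → ℤ` and a linear form `φ` with `ν μ = φ μ` and `φ = D • φ₀`, `D ≠ 0`. [folklore] -/
theorem exists_int_weights (φ₀ : p.SplittingField →ₗ[ℚ] ℚ) :
    ∃ (D : ℤ) (ν : p.rootSet p.SplittingField → ℤ), D ≠ 0 ∧
      ∀ μ, (ν μ : ℚ) = ((D : ℚ) • φ₀) μ := by
  let D : ℤ := ∏ μ : p.rootSet p.SplittingField, ((φ₀ μ).den : ℤ)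
  have hD : D ≠ 0 := Finset.prod_ne_zero_iff.2 fun μ _ => by exact_mod_cast (φ₀ μ).den_ne_zero
  refine ⟨D, fun μ => (φ₀ μ).num * (D / (φ₀ μ).den), hD, fun μ => ?_⟩
  have hdvd : ((φ₀ μ).den : ℤ) ∣ D := Finset.dvd_prod_of_mem _ (Finset.mem_univ μ)
  obtain ⟨k, hk⟩ := hdvd
  have hden : ((φ₀ μ).den : ℤ) ≠ 0 := by exact_mod_cast (φ₀ μ).den_ne_zero
  have hk' : D / (φ₀ μ).den = k := by rw [hk, Int.mul_ediv_cancel_left _ hden]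
  dsimp only
  rw [hk', LinearMap.smul_apply, smul_eq_mul, hk]
  push_cast
  rw [mul_assoc, mul_comm (k : ℚ), ← mul_assoc, mul_comm ((φ₀ μ).den : ℚ), Rat.mul_den_eq_num]

/-- **Existence of separating norm points.** Given finitely many weight vectors `M` whose
weighted root sums `Σ M(μ) μ` are non-zero, there are integral weights `ν` (restriction of a
linear form) and a scalar `c ≠ 0` such that the norm points `U = normPoint ν c` violate every
relation `∏ U(μ)^{M(μ)} = 1`, `M` in the family — while (by `prod_normPoint_zpow_eq_one`) they
satisfy all relations with `Σ M(μ) μ = 0`. Construction: `φ` a linear form not vanishing on the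
sums (`exists_dual_forall_ne_zero`), `c = r + α` with `α` a primitive element and `r ∈ ℚ` outside
the finite exceptional set of `finite_setOf_prod_add_zpow_eq_one` (the exponent of `c` itself in
`∏ U(μ)^{M(μ)}` is `φ(Σ M(μ) μ) ≠ 0`). This is the density of the rational (norm) points in the
torus (Borel, *Linear Algebraic Groups*, 8.13–8.14), in the explicit form needed here. [folklore] -/
theorem exists_normPoint_family (𝓜 : Finset (p.rootSet p.SplittingField → ℤ))
    (h𝓜 : ∀ M ∈ 𝓜, ∑ μ : p.rootSet p.SplittingField, M μ • (μ : p.SplittingField) ≠ 0) :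
    ∃ (ν : p.rootSet p.SplittingField → ℤ) (φ : p.SplittingField →ₗ[ℚ] ℚ) (c : p.SplittingField),
      (∀ μ, (ν μ : ℚ) = φ μ) ∧ c ≠ 0 ∧ ∀ M ∈ 𝓜, ∏ μ, normPoint ν c μ ^ M μ ≠ 1 := by
  classical
  -- a linear form not vanishing on the weighted root sums, made integral on the roots
  obtain ⟨φ₀, hφ₀⟩ := exists_dual_forall_ne_zero (K := ℚ)
    (𝓜.image fun M => ∑ μ : p.rootSet p.SplittingField, M μ • (μ : p.SplittingField)) (by
      intro w hw
      obtain ⟨M, hM, rfl⟩ := Finset.mem_image.1 hw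
      exact h𝓜 M hM)
  obtain ⟨D, ν, hD, hν⟩ := exists_int_weights φ₀
  have he : ∀ M ∈ 𝓜, normExponent ν M 1 ≠ 0 := by
    intro M hM h0
    have h := cast_normExponent_one ν ((D : ℚ) • φ₀) hν M
    rw [h0, Int.cast_zero, LinearMap.smul_apply, smul_eq_mul, eq_comm, mul_eq_zero] at h
    rcases h with h | h
    · exact hD (by exact_mod_cast h)
    · exact hφ₀ _ (Finset.mem_image_of_mem _ hM) h
  -- a primitive element and its distinct conjugates
  let pb := Field.powerBasisOfFiniteOfSeparable F p.SplittingField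
  have hinj : Function.Injective fun σ : p.Gal => σ pb.gen := by
    intro σ τ h
    exact AlgEquiv.coe_toAlgHom_injective (pb.algHom_ext h)
  -- the finitely many bad rationals
  let Bad : Set ℚ := {r | (r : p.SplittingField) + pb.gen = 0} ∪
    ⋃ M ∈ 𝓜, {r : ℚ | ∏ σ : p.Gal, ((r : p.SplittingField) + σ pb.gen) ^ normExponent ν M σ = 1}
  have hBad : Bad.Finite := by
    refine Set.Finite.union ?_ (Set.Finite.biUnion 𝓜.finite_toSet fun M hM => ?_)
    · have : {r : ℚ | (r : p.SplittingField) + pb.gen = 0} =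
          (fun r : ℚ => (r : p.SplittingField)) ⁻¹' {-pb.gen} := by
        ext r
        simp [add_eq_zero_iff_eq_neg]
      rw [this]
      exact Set.Finite.preimage (Rat.cast_injective.injOn) (Set.finite_singleton _)
    · exact finite_setOf_prod_add_zpow_eq_one (fun σ : p.Gal => σ pb.gen) hinj
        (normExponent ν M) (he M hM)
  obtain ⟨r, hr⟩ := hBad.infinite_compl.nonempty
  simp only [Bad, Set.mem_compl_iff, Set.mem_union, Set.mem_setOf_eq, Set.mem_iUnion, not_or,
    not_exists] at hr
  refine ⟨ν, (D : ℚ) • φ₀, (r : p.SplittingField) + pb.gen, hν, hr.1, fun M hM h1 => hr.2 M hM ?_⟩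
  rw [prod_normPoint_zpow_eq ν hr.1 M] at h1
  simpa only [map_add, map_ratCast] using h1

end Norm

end Literature.AlgebraicGeometry.Motives

end
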